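import Mathlib
import Summits.NavierStokesRegularity.NavierStokesRegularity.Theorems.WakeRatchetAdmissibleEternalBoundCritical
import Summits.NavierStokesRegularity.NavierStokesRegularity.Theses.WakeRatchet
import HarnessLib
import HarnessLib.Audit

/-!
# `WakeRatchet.AdmissibleEternalBound` (stmt-NavierStokesRegularity-23197) — negative lemma modulo
# SYMMETRIC BOUNCE WAVES: an admissible eternal solution with a time-reversal-symmetric terminal
# profile continues past its blow-up time; the continuation is admissible but NOT uniformly bounded

MODEL lattice ODEs only (Tao 2016 §4, §6.4); nothing in this file is a statement about the
Navier–Stokes equations, and nothing is settled unconditionally.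

THE MECHANISM (companion file `WakeRatchetAdmissibleEternalBoundCritical`).  In the critical variables
`V_n(t) = e^{σ}W_n(σ)`, `t = -e^{-σ}`, an admissible inviscid eternal solution is a solution of the
AUTONOMOUS quadratic lattice on `t < 0` with uniformly integrable shells, and the renormalisation centre
`t⋆ = 0` is invisible: if the physical solution continues shell-wise to `t < 1` with integrable shells,
`W'_n(σ') := e^{-σ'} V_n(1 - e^{-σ'})` is again admissible (`isEternal_recentre`) and
`‖W'‖ ≥ sup_{n,t<0} ‖V_n(t)‖ = sup_{n,σ} e^{σ}‖W_n(σ)‖`, infinite as soon as `W` blows up at its own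
`t⋆` (true for every DSS wave: `e^{nT}‖Φ(0)‖ → ∞`).  A continuation is supplied by TIME REVERSAL: the
lattice is quadratic, so for every linear `g` with `Q∘g = -g∘Q`, `A∘g = -g∘A`, `B∘(g×g) = -g∘B`
(«anti-symmetry»; `g = -id` always qualifies, and so does the flip of the odd modes of a parity-graded
table) `t ↦ g V(-t)` is again a solution; it glues `C¹` to `V` at `t = 0` iff the TERMINAL PROFILE
`r_n = lim_{σ→∞} e^{σ} W_n(σ)` is `g`-fixed (`hasDerivAt_bounce`; the action of the glued field is at
most `(1 + ‖g‖)M`, `integral_bounce_le`).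

* `exists_not_uniformBound_of_bounce` — the bounce of such a `W` is an admissible eternal solution of
  the SAME table that is not uniformly bounded.
* `SymmetricBounceWaves` (the construction item, `@[conjecture]`): at some spread `R ≥ 1` and at
  arbitrarily small scale ratios, some table of E₂(R) carries an anti-symmetry `g` and an admissible
  inviscid eternal solution that blows up at its own `t⋆` and whose terminal profile is `g`-fixed.
  For a DSS wave `W_n(σ) = Φ(σ - nT)` all terminal vectors are parallel (`r_n = e^{nT} Φ_∞`), so this
  is ONE vector condition `g Φ_∞ = Φ_∞` on a DSS blow-up wave of a graded table; no such wave is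
  constructed in print (the travelling-wave picture of shell-model blow-up is numerical).
* `AdmissibleEternalBound_false_of_SymmetricBounceWaves : SymmetricBounceWaves → ¬ AdmissibleEternalBound`.

HONEST FRAMING: a conditional refutation.  It shows that the crux, as filed, forbids every admissible
solution from being continued admissibly past its own blow-up time — an assertion about objects the
parent K2ᵛ extraction (stmt-20420) never produces.
-/

noncomputable section

set_option linter.dupNamespace false

namespace Summit.NavierStokesRegularity.NavierStokesRegularity.Theorems

namespace WakeRatchetBounce

open Filter Topology MeasureTheory Set
open scoped RealInnerProductSpace
open Literature.Analysis.FluidPDE Literature.Analysis.FluidPDE.TaoCascade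
open WakeRatchetCritical TransitMassLedgerEnergy

variable {m : ℕ}

section Bounce

variable {ε₀ : ℝ} {α : Fin m → Fin m → Fin m → ℤ × ℤ × ℤ → ℝ}

/-- **Gluing the time-reversed image.**  Let `V` solve the autonomous lattice on `t < 0` with
one-sided limits `V_n(t) → r_n` (`t → 0⁻`), let `g` be a linear anti-symmetry of the table fixing every
`r_n`, and let `Vb` be `V` on `t < 0`, `r` at `t = 0` and the mirror image `g V(-t)` on `t > 0`.  Then
`Vb` solves the lattice at EVERY time (the two one-sided derivatives at `0` agree because
`F(g r) = -g F(r) ` and `g r = r`).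
[cite: Tao2016AveragedNS, §4 Lemma 4.1 (4.8), §6.4; cell vocabulary (time reversal of the quadratic lattice)] -/
theorem hasDerivAt_bounce {V Vb : ℤ → ℝ → Em m} (g : Em m →L[ℝ] Em m) {r : ℤ → Em m}
    (hgQ : ∀ x, tableQ α (g x) = -(g (tableQ α x)))
    (hgA : ∀ x, tableA α (g x) = -(g (tableA α x)))
    (hgB : ∀ y x, tableB α (g y) (g x) = -(g (tableB α y x)))
    (hVder : ∀ (n : ℤ) (t : ℝ), t < 0 → HasDerivAt (V n)
      (tableQ α (V n t) + bigLam ε₀ • tableA α (V (n - 1) t)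
        + (bigLam ε₀)⁻¹ • tableB α (V (n + 1) t) (V n t)) t)
    (hV_left : ∀ n : ℤ, Tendsto (V n) (𝓝[<] (0 : ℝ)) (𝓝 (r n)))
    (hfix : ∀ n, g (r n) = r n)
    (hVb_neg : ∀ (n : ℤ) (t : ℝ), t < 0 → Vb n t = V n t) (hVb_zero : ∀ n : ℤ, Vb n 0 = r n)
    (hVb_pos : ∀ (n : ℤ) (t : ℝ), 0 < t → Vb n t = g (V n (-t))) (n : ℤ) (t : ℝ) :
    HasDerivAt (Vb n)
      (tableQ α (Vb n t) + bigLam ε₀ • tableA α (Vb (n - 1) t)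
        + (bigLam ε₀)⁻¹ • tableB α (Vb (n + 1) t) (Vb n t)) t := by
  -- (B) `Vb` solves the lattice at every `t < 0`
  have hder_neg : ∀ (n : ℤ) (t : ℝ), t < 0 → HasDerivAt (Vb n)
      (tableQ α (Vb n t) + bigLam ε₀ • tableA α (Vb (n - 1) t)
        + (bigLam ε₀)⁻¹ • tableB α (Vb (n + 1) t) (Vb n t)) t := by
    intro n t ht
    have hEq : Vb n =ᶠ[𝓝 t] V n :=
      Filter.eventually_of_mem (Iio_mem_nhds ht) fun s hs => hVb_neg n s hs
    rw [hVb_neg n t ht, hVb_neg (n - 1) t ht, hVb_neg (n + 1) t ht]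
    exact (hVder n t ht).congr_of_eventuallyEq hEq
  -- (C) the time-reversed image solves the lattice at every `t > 0`
  have hder_pos : ∀ (n : ℤ) (t : ℝ), 0 < t → HasDerivAt (Vb n)
      (tableQ α (Vb n t) + bigLam ε₀ • tableA α (Vb (n - 1) t)
        + (bigLam ε₀)⁻¹ • tableB α (Vb (n + 1) t) (Vb n t)) t := by
    intro n t ht
    have h1 := hVder n (-t) (by linarith)
    have h2 := h1.scomp t (hasDerivAt_neg t)
    have h3 := g.hasFDerivAt.comp_hasDerivAt t h2
    have hEq : Vb n =ᶠ[𝓝 t] (⇑g ∘ (V n ∘ Neg.neg)) :=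
      Filter.eventually_of_mem (Ioi_mem_nhds ht) fun s hs => by
        rw [hVb_pos n s hs]; rfl
    refine (h3.congr_of_eventuallyEq hEq).congr_deriv ?_
    rw [hVb_pos n t ht, hVb_pos (n - 1) t ht, hVb_pos (n + 1) t ht, hgQ, hgA, hgB]
    simp only [map_smul, map_add, map_neg, smul_neg, neg_smul, one_smul, smul_add]
  -- (D) continuity of the glued field at `t = 0`
  have hcont : ∀ n : ℤ, ContinuousAt (Vb n) 0 := by
    intro n
    rw [continuousAt_iff_continuous_left'_right']
    constructor
    · show Tendsto (Vb n) (𝓝[<] (0 : ℝ)) (𝓝 (Vb n 0))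
      rw [hVb_zero]
      refine (hV_left n).congr' ?_
      filter_upwards [self_mem_nhdsWithin] with t ht
      exact (hVb_neg n t ht).symm
    · show Tendsto (Vb n) (𝓝[>] (0 : ℝ)) (𝓝 (Vb n 0))
      rw [hVb_zero]
      have h1 : Tendsto (fun t : ℝ => -t) (𝓝[>] (0 : ℝ)) (𝓝[<] (0 : ℝ)) := by
        simpa using (tendsto_neg_nhdsGT (a := (0 : ℝ)))
      have h2 : Tendsto (fun t : ℝ => g (V n (-t))) (𝓝[>] (0 : ℝ)) (𝓝 (g (r n))) :=
        (g.continuous.tendsto (r n)).comp ((hV_left n).comp h1)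
      rw [hfix] at h2
      refine h2.congr' ?_
      filter_upwards [self_mem_nhdsWithin] with t ht
      exact (hVb_pos n t ht).symm
  -- (E) gluing at `t = 0`: the right-hand side is continuous there
  have hQ : Tendsto (fun t : ℝ => tableQ α (Vb n t)) (𝓝 0) (𝓝 (tableQ α (Vb n 0))) :=
    ((continuous_tableQ α).tendsto _).comp (hcont n)
  have hA : Tendsto (fun t : ℝ => bigLam ε₀ • tableA α (Vb (n - 1) t)) (𝓝 0)
      (𝓝 (bigLam ε₀ • tableA α (Vb (n - 1) 0))) :=
    (((continuous_tableA α).tendsto _).comp (hcont (n - 1))).const_smul _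
  have hB : Tendsto (fun t : ℝ => (bigLam ε₀)⁻¹ • tableB α (Vb (n + 1) t) (Vb n t)) (𝓝 0)
      (𝓝 ((bigLam ε₀)⁻¹ • tableB α (Vb (n + 1) 0) (Vb n 0))) :=
    (((continuous_tableB α).tendsto (Vb (n + 1) 0, Vb n 0)).comp
      ((hcont (n + 1)).prodMk_nhds (hcont n))).const_smul _
  have hFcont : ContinuousAt (fun t : ℝ => tableQ α (Vb n t) + bigLam ε₀ • tableA α (Vb (n - 1) t)
      + (bigLam ε₀)⁻¹ • tableB α (Vb (n + 1) t) (Vb n t)) 0 :=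
    (hQ.add hA).add hB
  exact hasDerivAt_of_hasDerivAt_of_ne'
    (g := fun t : ℝ => tableQ α (Vb n t) + bigLam ε₀ • tableA α (Vb (n - 1) t)
      + (bigLam ε₀)⁻¹ • tableB α (Vb (n + 1) t) (Vb n t))
    (fun y hy => (lt_or_gt_of_ne hy).elim (hder_neg n y) (hder_pos n y)) (hcont n) hFcont t

/-- **Action of the glued field.**  If `Vb` is `V` on `t < 0` and the mirror image `g V(-t)` on `t > 0`,
`Vb` is continuous and `‖V‖` is integrable on `(-∞, 0)` with integral at most `M`, then `‖Vb‖` is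
integrable on `(-∞, 1)` with integral at most `(1 + ‖g‖) M`.
[folklore (change of variables `t ↦ -t`); cell vocabulary (action of `IsEternal`)] -/
theorem integral_bounce_le {U Ub : ℝ → Em m} (g : Em m →L[ℝ] Em m) {M : ℝ}
    (hUb_neg : ∀ t : ℝ, t < 0 → Ub t = U t) (hUb_pos : ∀ t : ℝ, 0 < t → Ub t = g (U (-t)))
    (hcont : Continuous Ub) (hint : IntegrableOn (fun t => ‖U t‖) (Iio 0))
    (hle : ∫ t in Iio (0 : ℝ), ‖U t‖ ≤ M) :
    IntegrableOn (fun t => ‖Ub t‖) (Iio 1) ∧ ∫ t in Iio (1 : ℝ), ‖Ub t‖ ≤ (1 + ‖g‖) * M := by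
  -- on `t < 0`
  have hEqOn : EqOn (fun t => ‖Ub t‖) (fun t => ‖U t‖) (Iio 0) := fun t ht => by
    simp only [hUb_neg t ht]
  have hI1 : IntegrableOn (fun t => ‖Ub t‖) (Iio 0) := hint.congr_fun hEqOn.symm measurableSet_Iio
  have hE1 : ∫ t in Iio (0 : ℝ), ‖Ub t‖ = ∫ t in Iio (0 : ℝ), ‖U t‖ :=
    setIntegral_congr_fun measurableSet_Iio hEqOn
  -- on `0 ≤ t < 1`: continuity gives integrability, the mirror gives the bound
  have hI2 : IntegrableOn (fun t => ‖Ub t‖) (Ico 0 1) :=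
    ((hcont.norm).continuousOn.integrableOn_Icc).mono_set Ico_subset_Icc_self
  have hint' : IntegrableOn (fun t => ‖U t‖) (Iio (-0)) := by rw [neg_zero]; exact hint
  have hUneg : IntegrableOn (fun t : ℝ => ‖U (-t)‖) (Ioi 0) := hint'.comp_neg_Ioi
  have hE2 : ∫ t in Ico (0 : ℝ) 1, ‖Ub t‖ ≤ ‖g‖ * M := by
    rw [setIntegral_congr_set (Ioo_ae_eq_Ico (a := (0 : ℝ)) (b := 1)).symm]
    have hmono : ∫ t in Ioo (0 : ℝ) 1, ‖Ub t‖ ≤ ∫ t in Ioo (0 : ℝ) 1, ‖g‖ * ‖U (-t)‖ := by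
      refine setIntegral_mono_on (hI2.mono_set Ioo_subset_Ico_self)
        ((hUneg.mono_set Ioo_subset_Ioi_self).const_mul ‖g‖) measurableSet_Ioo fun t ht => ?_
      rw [hUb_pos t ht.1]
      exact g.le_opNorm _
    have hbig : ∫ t in Ioo (0 : ℝ) 1, ‖g‖ * ‖U (-t)‖ ≤ ‖g‖ * ∫ t in Iio (0 : ℝ), ‖U t‖ := by
      rw [integral_const_mul]
      refine mul_le_mul_of_nonneg_left ?_ (norm_nonneg _)
      calc ∫ t in Ioo (0 : ℝ) 1, ‖U (-t)‖ ≤ ∫ t in Ioi (0 : ℝ), ‖U (-t)‖ :=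
            setIntegral_mono_set hUneg (Filter.Eventually.of_forall fun t => norm_nonneg _)
              Ioo_subset_Ioi_self.eventuallyLE
        _ = ∫ t in Iic (-0 : ℝ), ‖U t‖ := integral_comp_neg_Ioi 0 (fun t => ‖U t‖)
        _ = ∫ t in Iic (0 : ℝ), ‖U t‖ := by rw [neg_zero]
        _ = ∫ t in Iio (0 : ℝ), ‖U t‖ := setIntegral_congr_set Iio_ae_eq_Iic.symm
    calc ∫ t in Ioo (0 : ℝ) 1, ‖Ub t‖ ≤ ‖g‖ * ∫ t in Iio (0 : ℝ), ‖U t‖ := hmono.trans hbig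
      _ ≤ ‖g‖ * M := mul_le_mul_of_nonneg_left hle (norm_nonneg _)
  have hunion : Iio (1 : ℝ) = Iio 0 ∪ Ico 0 1 := (Iio_union_Ico_eq_Iio zero_le_one).symm
  have hdisj : Disjoint (Iio (0 : ℝ)) (Ico 0 1) :=
    disjoint_left.2 fun t ht ht' => absurd ht (not_lt.2 ht'.1)
  refine ⟨by rw [hunion]; exact hI1.union hI2, ?_⟩
  rw [hunion, setIntegral_union hdisj measurableSet_Ico hI1 hI2, hE1]
  calc (∫ t in Iio (0 : ℝ), ‖U t‖) + ∫ t in Ico (0 : ℝ) 1, ‖Ub t‖ ≤ M + ‖g‖ * M := add_le_add hle hE2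
    _ = (1 + ‖g‖) * M := by ring

variable {W : ℤ → ℝ → Em m}

/-- **The bounce.**  Let `W` be an admissible inviscid eternal solution of the table `α`, `g` a linear
ANTI-SYMMETRY of the table (`Q∘g = -g∘Q`, `A∘g = -g∘A`, `B∘(g×g) = -g∘B`; time reversal composed
with `g` maps solutions to solutions), and suppose the terminal profile `r_n = lim_{σ→∞} e^{σ}W_n(σ)`
is `g`-fixed while `W` blows up at its own `t⋆` (`sup_{n,σ} e^{σ}‖W_n(σ)‖ = ∞`).  Then gluing the
time-reversed image `g V(-t)` to the critical-variable solution `V` at `t = 0` and re-centring the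
renormalisation at `t⋆ = 1` produces an admissible eternal solution of the same table that is NOT
uniformly bounded.
[cite: Tao2016AveragedNS, §4 Lemma 4.1 (4.8), §6.4 (self-similar variables); cell vocabulary (`IsEternal`, `UniformBound`)] -/
theorem exists_not_uniformBound_of_bounce (hW : IsEternal ε₀ α W) (g : Em m →L[ℝ] Em m)
    (hgQ : ∀ x, tableQ α (g x) = -(g (tableQ α x)))
    (hgA : ∀ x, tableA α (g x) = -(g (tableA α x)))
    (hgB : ∀ y x, tableB α (g y) (g x) = -(g (tableB α y x)))
    (r : ℤ → Em m) (hr : ∀ n, Tendsto (fun σ => Real.exp σ • W n σ) atTop (𝓝 (r n)))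
    (hfix : ∀ n, g (r n) = r n)
    (hblow : ∀ K : ℝ, ∃ (n : ℤ) (σ : ℝ), K < Real.exp σ * ‖W n σ‖) :
    ∃ W' : ℤ → ℝ → Em m, IsEternal ε₀ α W' ∧ ¬ UniformBound W' := by
  classical
  -- the critical-variable solution on `t < 0`
  set V : ℤ → ℝ → Em m := fun n t => (-t)⁻¹ • W n (-Real.log (-t)) with hV
  -- (A) `V` solves the autonomous lattice on `t < 0` and has one-sided limits `r`
  have hVder : ∀ (n : ℤ) (t : ℝ), t < 0 → HasDerivAt (V n)
      (tableQ α (V n t) + bigLam ε₀ • tableA α (V (n - 1) t)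
        + (bigLam ε₀)⁻¹ • tableB α (V (n + 1) t) (V n t)) t := by
    intro n t ht
    have h := hasDerivAt_crit (ε₀ := ε₀) (α := α) (W := W) (n := n) ht (hW.law n _)
    simpa only [hV] using h
  have hV_left : ∀ n : ℤ, Tendsto (V n) (𝓝[<] (0 : ℝ)) (𝓝 (r n)) := by
    intro n
    have h := (hr n).comp tendsto_negLogNeg_nhdsLT_zero
    refine h.congr' ?_
    filter_upwards [self_mem_nhdsWithin] with t ht
    simp only [Function.comp_apply, hV]
    exact (crit_eq_exp_smul (W n) ht).symm
  -- the glued field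
  obtain ⟨Vb, hVb_neg, hVb_zero, hVb_pos⟩ : ∃ Vb : ℤ → ℝ → Em m,
      (∀ (n : ℤ) (t : ℝ), t < 0 → Vb n t = V n t) ∧ (∀ n : ℤ, Vb n 0 = r n) ∧
      (∀ (n : ℤ) (t : ℝ), 0 < t → Vb n t = g (V n (-t))) := by
    refine ⟨fun n t => if t < 0 then V n t else if t = 0 then r n else g (V n (-t)),
      fun n t ht => ?_, fun n => ?_, fun n t ht => ?_⟩
    · simp only [if_pos ht]
    · simp only [lt_irrefl, if_false, if_true]
    · simp only [if_neg (not_lt.2 ht.le), if_neg ht.ne']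
  -- (B)–(E) it solves the lattice everywhere
  have hall := hasDerivAt_bounce (ε₀ := ε₀) g hgQ hgA hgB hVder hV_left hfix hVb_neg hVb_zero hVb_pos
  have hVb_cont : ∀ n : ℤ, Continuous (Vb n) := fun n =>
    continuous_iff_continuousAt.2 fun t => (hall n t).continuousAt
  -- (F) its action on `t < 1`
  obtain ⟨M, hM⟩ := hW.action
  have hint : ∀ n : ℤ, IntegrableOn (fun t => ‖Vb n t‖) (Iio 1)
      ∧ ∫ t in Iio 1, ‖Vb n t‖ ≤ (1 + ‖g‖) * M := by
    intro n
    have hcrit := integral_crit_eq (W n)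
    have hVint : IntegrableOn (fun t => ‖V n t‖) (Iio 0) := by
      simpa only [hV] using hcrit.1.1 (hM n).1
    have hVeq : ∫ t in Iio (0 : ℝ), ‖V n t‖ = ∫ σ, ‖W n σ‖ := by
      simpa only [hV] using hcrit.2 (hM n).1
    exact integral_bounce_le g (hVb_neg n) (hVb_pos n) (hVb_cont n) hVint (hVeq ▸ (hM n).2)
  -- (G) boundedness near the new centre `t = 1`
  have hbd : ∀ n : ℤ, ∃ P : ℝ, ∀ t : ℝ, 1 / 2 ≤ t → t < 1 → ‖Vb n t‖ ≤ P := by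
    intro n
    obtain ⟨P, hP⟩ := isCompact_Icc.exists_bound_of_continuousOn
      ((hVb_cont n).continuousOn (s := Icc (1 / 2 : ℝ) 1))
    exact ⟨P, fun t h1 h2 => hP t ⟨h1, h2.le⟩⟩
  -- (H) re-centre at `t⋆ = 1`
  have hall' : ∀ (n : ℤ) (t : ℝ), t < 1 → HasDerivAt (Vb n)
      (tableQ α (Vb n t) + bigLam ε₀ • tableA α (Vb (n - 1) t)
        + (bigLam ε₀)⁻¹ • tableB α (Vb (n + 1) t) (Vb n t)) t := fun n t _ => hall n t
  refine ⟨fun n σ => Real.exp (-σ) • Vb n (1 - Real.exp (-σ)), isEternal_recentre hall' hint hbd, ?_⟩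
  -- (I) the re-centred solution is not uniformly bounded
  rintro ⟨C, hC⟩
  obtain ⟨n, σ, hK⟩ := hblow C
  set σ' : ℝ := -Real.log (1 + Real.exp (-σ)) with hσ'
  have hpos : 0 < 1 + Real.exp (-σ) := by positivity
  have he : Real.exp (-σ') = 1 + Real.exp (-σ) := by
    rw [hσ', neg_neg, Real.exp_log hpos]
  have ht : 1 - Real.exp (-σ') = -Real.exp (-σ) := by rw [he]; ring
  have hneg : -Real.exp (-σ) < 0 := neg_neg_iff_pos.2 (Real.exp_pos _)
  have hval : Vb n (1 - Real.exp (-σ')) = Real.exp σ • W n σ := by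
    rw [ht, hVb_neg n _ hneg, hV]
    simp only [neg_neg, Real.log_exp]
    rw [Real.exp_neg, inv_inv]
  have hnorm : ‖Real.exp (-σ') • Vb n (1 - Real.exp (-σ'))‖
      = (1 + Real.exp (-σ)) * (Real.exp σ * ‖W n σ‖) := by
    rw [hval, norm_smul, norm_smul, he, Real.norm_eq_abs, Real.norm_eq_abs, abs_of_pos hpos,
      abs_of_pos (Real.exp_pos σ)]
  have hCn := hC n σ'
  rw [hnorm] at hCn
  have hge : Real.exp σ * ‖W n σ‖ ≤ (1 + Real.exp (-σ)) * (Real.exp σ * ‖W n σ‖) := by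
    have h0 : 0 ≤ Real.exp σ * ‖W n σ‖ := by positivity
    nlinarith [Real.exp_pos (-σ)]
  linarith

end Bounce

/-! ## The construction item and the negative lemma -/

/-- **The construction `AdmissibleEternalBound` is refuted modulo: SYMMETRIC BOUNCE WAVES at
arbitrarily small scale ratios.**  At some spread `R ≥ 1`, for every `ε > 0` there are `ε₀ ∈ (0, ε]`, a
table `α ∈ E₂(R)` with a linear anti-symmetry `g` (`Q∘g = -g∘Q`, `A∘g = -g∘A`, `B∘(g×g) = -g∘B`; e.g.
the flip of the odd modes of a parity-graded table), and an admissible INVISCID eternal solution `W`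
of `α` whose terminal profile `r_n = lim_{σ→∞} e^{σ} W_n(σ)` is `g`-fixed and which blows up at its own
`t⋆` (`sup_{n,σ} e^{σ}‖W_n(σ)‖ = ∞`; automatic for DSS waves, whose terminal vectors are moreover all
parallel: `r_n = e^{nT} Φ_∞`, so the symmetry is ONE vector condition `g Φ_∞ = Φ_∞`).  No such wave is
constructed in print (shell-model blow-up profiles are numerical).
[cite: Tao2016AveragedNS, §4 Lemma 4.1 (4.8), §6.4; cell vocabulary (construction item for stmt-23197)] -/
@[conjecture] def SymmetricBounceWaves : Prop :=
  ∃ R : ℝ, 1 ≤ R ∧ ∀ εs : ℝ, 0 < εs → ∃ ε₀ : ℝ, 0 < ε₀ ∧ ε₀ ≤ εs ∧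
    ∃ α : Fin 4 → Fin 4 → Fin 4 → ℤ × ℤ × ℤ → ℝ, InTableClass R α ∧
    ∃ g : Em 4 →L[ℝ] Em 4,
      (∀ x, tableQ α (g x) = -(g (tableQ α x))) ∧ (∀ x, tableA α (g x) = -(g (tableA α x))) ∧
      (∀ y x, tableB α (g y) (g x) = -(g (tableB α y x))) ∧
    ∃ W : ℤ → ℝ → Em 4, IsEternal ε₀ α W ∧
      (∃ r : ℤ → Em 4, (∀ n, Tendsto (fun σ => Real.exp σ • W n σ) atTop (𝓝 (r n))) ∧
        ∀ n, g (r n) = r n) ∧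
      ∀ K : ℝ, ∃ (n : ℤ) (σ : ℝ), K < Real.exp σ * ‖W n σ‖

/-- **Negative lemma: `SymmetricBounceWaves → ¬ AdmissibleEternalBound`.**  The bounce of a symmetric
wave is an admissible eternal solution (`ν̂ = 0`) of a comparable table, at an arbitrarily small scale
ratio, that is not uniformly bounded — contradicting the crux below its threshold.
[cite: Tao2016AveragedNS, §4, §6.4; cell vocabulary (stmt-NavierStokesRegularity-23197)] -/
theorem AdmissibleEternalBound_false_of_SymmetricBounceWaves :
    SymmetricBounceWaves →
      ¬ Summit.NavierStokesRegularity.NavierStokesRegularity.Theses.WakeRatchet.AdmissibleEternalBound := by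
  rintro ⟨R, hR, H⟩ hS
  obtain ⟨εs, hεs, HS⟩ := hS R hR
  obtain ⟨ε₀, hε₀, hle, α, hα, g, hgQ, hgA, hgB, W, hW, ⟨r, hr, hfix⟩, hblow⟩ := H εs hεs
  obtain ⟨W', hW', hnot⟩ := exists_not_uniformBound_of_bounce hW g hgQ hgA hgB r hr hfix hblow
  exact hnot (HS ε₀ hε₀ hle α hα 0 W' hW'.isEternalVisc)

end WakeRatchetBounce

end Summit.NavierStokesRegularity.NavierStokesRegularity.Theorems
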